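import Summits.SmoothPoincare4.SmoothPoincare4.Theorems.SullivanDualWitnessChargeOfPencilOrRescale
import Summits.SmoothPoincare4.SmoothPoincare4.Theorems.SullivanDualWitnessChargeSubstubFar
import Summits.SmoothPoincare4.SmoothPoincare4.Theorems.SullivanDualWitnessChargeCompletePackaging
import Mathlib.Analysis.Complex.Basic
import Summits.SmoothPoincare4.SmoothPoincare4.Theorems.SullivanDualWitnessChargeBlowupCurve
import Summits.SmoothPoincare4.SmoothPoincare4.Theorems.SullivanDualWitnessChargeHelperLimitExtract
import Summits.SmoothPoincare4.SmoothPoincare4.Theorems.SullivanDualWitnessChargeHelperLimitFar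
import Summits.SmoothPoincare4.SmoothPoincare4.Theorems.SullivanDualWitnessChargeHelperLimitConvY
import Summits.SmoothPoincare4.SmoothPoincare4.Theorems.SullivanDualWitnessChargeHelperLimitBounds
import Summits.SmoothPoincare4.SmoothPoincare4.Theorems.SullivanDualWitnessChargeHelperLimitHoloFar
import Summits.SmoothPoincare4.SmoothPoincare4.Theorems.SullivanDualWitnessChargeHelperLimitProperSep
import Summits.SmoothPoincare4.SmoothPoincare4.Theorems.SullivanDualHyperbolicEndStandardSphere
import Summits.SmoothPoincare4.SmoothPoincare4.Theorems.SullivanDualWitnessChargeHelperFamilyProper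
import Summits.SmoothPoincare4.SmoothPoincare4.Theorems.SullivanDualWitnessChargeHelperDiffeoOfProperInjective
import Summits.SmoothPoincare4.SmoothPoincare4.Theorems.SullivanDualWitnessChargeHelperFarMemberIsFarLine
import Summits.SmoothPoincare4.SmoothPoincare4.Theorems.SullivanDualWitnessChargeHelperInjectiveOfProper
import Summits.SmoothPoincare4.SmoothPoincare4.Theorems.SullivanDualWitnessChargeHelperFamilyUnique
import Summits.SmoothPoincare4.SmoothPoincare4.Theorems.SullivanDualWitnessChargeHelperFamilyExtend
import Summits.SmoothPoincare4.SmoothPoincare4.Theorems.SullivanDualWitnessChargeHelperFarFamily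
import Summits.SmoothPoincare4.SmoothPoincare4.Theorems.SullivanDualWitnessChargeHelperContinuityStep
import Summits.SmoothPoincare4.SmoothPoincare4.Theorems.SullivanDualWitnessChargeHelperContinuityMethod
import Mathlib.Geometry.Manifold.WhitneyEmbedding
import Mathlib.Topology.Sequences

/-!
# Reduction of the crux `WitnessCharge` to the two deep stubs of skeleton v7 (line `Sketch`)

Crux `WitnessCharge` (stmt-SmoothPoincare4-7824), line `Sketch` (idea `pencil-incompleteness`),
continuation lead c4, cycle 4. This file is the sorry-free TREE form of skeleton v7b
(`Cruxes/WitnessCharge/Lines/Sketch.lean`): it proves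

  `WitnessCharge_of_localFamilyUniv_of_limitEmbedded :
      (A' = substub_localFamilyUniv, as a hypothesis) → (D1b = substub_limitEmbedded, as a
      hypothesis) → Theses.SullivanDual.WitnessCharge`,

so that the crux is CLOSED MODULO the two deep inputs — A' (Hofer–Lizan–Sikorav automatic
transversality + the implicit-function-theorem chart of the moduli space of pencil members:
existence AND universality) and D1b (McDuff 1991 §4: limits of embedded `J`-discs with embedded
separated collar are embedded) — and nothing else: every other step of Gromov's pencil argument
for an untamed `J` standard at infinity is a landed theorem of cycles 1–4 (far lines, flat chart,
confinement, uniform far control, extraction and far structure of limits, blow-up ⇒ `CurveAway`,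
far members are far lines, uniqueness/extension/continuity method for families, covering
injectivity, diffeomorphism packaging, exact taming, STEP 0 on witnesses, bubble confinement, and
the reduction `WitnessCharge_of_pencilOrRescale`).

Contents: `substub_limitMemberConv_of` (the limit machinery with the convergence kept, from D1b),
`pencilOrRescale_of_localFamilyUniv_of_limitEmbedded` (the hard stub of skeleton v2 from A' and
D1b) and the composition.
-/

noncomputable section

set_option linter.dupNamespace false

open scoped Manifold ContDiff Topology
open Set Filter Literature.Geometry.Kaehler Literature.Geometry.Symplectic
  Literature.Topology.FourManifolds

namespace Summit.SmoothPoincare4.SmoothPoincare4.Theorems.WitnessCharge.PencilIncompleteness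

/-- **LIM⁺ from D1b.** GIVEN the deep statement D1b (`C⁰_loc`-limits of embedded entire
`J`-curves with embedded separated collar are embedded on the disc), members with bounded
convergent intercepts and locally bounded gradients (through a Whitney embedding `ι`) have a
subsequence converging uniformly on compacts to a MEMBER of the limit intercept: extraction
`helper_limitExtract`, far structure `helper_limitFar`, `helper_limitConvY`, `helper_limitBounds`,
`helper_limitHoloFar`, `helper_limitProperSep` (all landed), and D1b on the core disc. -/
theorem substub_limitMemberConv_of
    (hD1b : ∀ (S : HomotopySphere 4) (p : S.carrier)
      (J : ∀ x : punctured p, TangentSpace (𝓡 4) x →L[ℝ] TangentSpace (𝓡 4) x),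
      (∀ (x : punctured p) (v : TangentSpace (𝓡 4) x), J x (J x v) = -v) →
      (∀ x₀ : punctured p, ContMDiffAt (𝓡 4) 𝓘(ℝ, EuclideanSpace ℝ (Fin 4) →L[ℝ] EuclideanSpace ℝ (Fin 4)) ∞
        (inTangentCoordinates (𝓡 4) (𝓡 4) (id : punctured p → punctured p) id (fun x => J x) x₀) x₀) →
      ∀ (N : ℕ) (ι : S.carrier → EuclideanSpace ℝ (Fin N)),
        ContMDiff (𝓡 4) 𝓘(ℝ, EuclideanSpace ℝ (Fin N)) ∞ ι → Function.Injective ι →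
        (∀ x : S.carrier, Function.Injective (mfderiv (𝓡 4) 𝓘(ℝ, EuclideanSpace ℝ (Fin N)) ι x)) →
      ∀ (u : ℕ → ℂ → punctured p) (G : ℂ → punctured p) (r₀ r₁ : ℝ), 0 < r₀ → r₀ < r₁ →
        (∀ n, IsEntireJCurve (𝓡 4) J (u n)) → (∀ n, Function.Injective (u n)) →
        (∀ n (ξ : ℂ), Function.Injective (mfderiv 𝓘(ℝ, ℂ) (𝓡 4) (u n) ξ)) →
        ContMDiff 𝓘(ℝ, ℂ) (𝓡 4) ∞ G → IsJHolomorphic (𝓡 4) J G →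
        (∀ D : Set ℂ, IsCompact D →
          TendstoUniformlyOn (fun n ζ => ι (u n ζ).1) (fun ζ => ι (G ζ).1) atTop D) →
        Set.InjOn G {ξ : ℂ | r₀ < ‖ξ‖ ∧ ‖ξ‖ < r₁} →
        (∀ ξ : ℂ, r₀ < ‖ξ‖ → ‖ξ‖ < r₁ → Function.Injective (mfderiv 𝓘(ℝ, ℂ) (𝓡 4) G ξ)) →
        (∀ ξ ξ' : ℂ, ‖ξ‖ ≤ r₀ → r₀ < ‖ξ'‖ → ‖ξ'‖ < r₁ → G ξ ≠ G ξ') →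
        Set.InjOn G (Metric.ball (0 : ℂ) r₁) ∧
          ∀ ξ ∈ Metric.ball (0 : ℂ) r₁, Function.Injective (mfderiv 𝓘(ℝ, ℂ) (𝓡 4) G ξ)) :
    ∀ (S : HomotopySphere 4) (p : S.carrier)
      (J : ∀ x : punctured p, TangentSpace (𝓡 4) x →L[ℝ] TangentSpace (𝓡 4) x) (ε' : ℝ),
      0 < ε' →
      Metric.closedBall (extChartAt (𝓡 4) p p) ε' ⊆ (extChartAt (𝓡 4) p).target →
      (∀ (x : punctured p) (v : TangentSpace (𝓡 4) x), J x (J x v) = -v) →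
      (∀ x₀ : punctured p, ContMDiffAt (𝓡 4) 𝓘(ℝ, EuclideanSpace ℝ (Fin 4) →L[ℝ] EuclideanSpace ℝ (Fin 4)) ∞
        (inTangentCoordinates (𝓡 4) (𝓡 4) (id : punctured p → punctured p) id (fun x => J x) x₀) x₀) →
      (∀ x : punctured p, InPuncturedChartBall p ε' x →
        ∀ (v : TangentSpace (𝓡 4) x) (b : EuclideanSpace ℝ (Fin 4)),
          inner ℝ (fderiv ℝ inversion (extChartAt (𝓡 4) p x.1 - extChartAt (𝓡 4) p p)
            (mfderiv (𝓡 4) 𝓘(ℝ, EuclideanSpace ℝ (Fin 4))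
              (fun z : punctured p => extChartAt (𝓡 4) p z.1) x (J x v))) b
          = stdSymplecticForm (fderiv ℝ inversion (extChartAt (𝓡 4) p x.1 - extChartAt (𝓡 4) p p)
            (mfderiv (𝓡 4) 𝓘(ℝ, EuclideanSpace ℝ (Fin 4))
              (fun z : punctured p => extChartAt (𝓡 4) p z.1) x v)) b) →
      ∀ (N : ℕ) (ι : S.carrier → EuclideanSpace ℝ (Fin N)),
        ContMDiff (𝓡 4) 𝓘(ℝ, EuclideanSpace ℝ (Fin N)) ∞ ι → Function.Injective ι →
        (∀ x : S.carrier, Function.Injective (mfderiv (𝓡 4) 𝓘(ℝ, EuclideanSpace ℝ (Fin N)) ι x)) →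
      ∀ (u : ℕ → ℂ → punctured p) (b : ℕ → ℂ) (bstar : ℂ) (B : ℝ),
        (∀ n, IsPencilMember J (u n) (b n)) → (∀ n, ‖b n‖ ≤ B) →
        Tendsto b atTop (𝓝 bstar) →
        (∀ r : ℝ, ∃ L : ℝ, ∀ n : ℕ, ∀ ξ : ℂ, ‖ξ‖ ≤ r →
          ‖fderiv ℝ (fun w : ℂ => ι (u n w).1) ξ‖ ≤ L) →
        ∃ (G : ℂ → punctured p) (φ : ℕ → ℕ), StrictMono φ ∧ IsPencilMember J G bstar ∧
          ∀ D : Set ℂ, IsCompact D →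
            TendstoUniformlyOn (fun n ζ => ι (u (φ n) ζ).1) (fun ζ => ι (G ζ).1) atTop D := by
  intro S p J ε' hε' hball hJ2 hJs hJstd N ι hι hιinj hιd u b bstar B hu hB hblim hgrad
  -- uniform confinement of the members on every disc
  have hnear := helper_memberNearBound_of helper_memberFarCovers
  have hK : ∀ r : ℝ, ∃ K : Set (punctured p), IsCompact K ∧ ∀ n (ξ : ℂ), ‖ξ‖ ≤ r → u n ξ ∈ K := by
    intro r
    obtain ⟨η, hη, -, hηu⟩ := helper_memberUniform_of hnear S p J ε' hε' hball hJstd B r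
    refine ⟨{x : punctured p | ¬ InPuncturedChartBall p η x},
      Summit.SmoothPoincare4.SmoothPoincare4.Cruxes.HyperbolicEnd.Sketch.isCompact_setOf_not_inPuncturedChartBall
        p hη, fun n ξ hξ => hηu (u n) (b n) (hu n) (hB n) ξ hξ⟩
  -- extraction
  obtain ⟨G, φ, hφ, hGs, hGJ, hunif⟩ := helper_limitExtract S p J hJ2 hJs N ι hι hιinj hιd u
    (fun n => (hu n).1) hK hgrad
  -- the radius `R`
  obtain ⟨R, hRdef⟩ : ∃ R : ℝ, R = max ε'⁻¹ B + 1 := ⟨_, rfl⟩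
  have hR : ε'⁻¹ < R := by rw [hRdef]; linarith [le_max_left ε'⁻¹ B]
  have hR0 : 0 < R := (inv_pos.2 hε').trans hR
  have hGcont : Continuous G := hGs.continuous
  have hucont : ∀ n, Continuous (u n) := fun n => (hu n).1.contMDiff.continuous
  have hpt : ∀ ξ : ℂ, Tendsto (fun k => u (φ k) ξ) atTop (𝓝 (G ξ)) := by
    intro ξ
    have hemb : Topology.IsEmbedding (fun x : punctured p => ι x.1) :=
      (hι.continuous.isClosedEmbedding hιinj).isEmbedding.comp Topology.IsEmbedding.subtypeVal
    rw [hemb.tendsto_nhds_iff]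
    exact ((hunif {ξ} isCompact_singleton).tendsto_at (mem_singleton ξ))
  have hfar := helper_limitFar S p J ε' hε' hball hJstd u b B G φ hu hB hpt R hR
  have hGfar : ∀ ξ : ℂ, 2 * R < ‖ξ‖ → InPuncturedChartBall p ε' (G ξ) := fun ξ hξ => (hfar ξ hξ).1
  obtain ⟨-, hconvY⟩ := helper_limitConvY S p ε' hε' N ι hι.continuous hιinj u G φ hucont hGcont
    hunif R hGfar
  obtain ⟨hdecay, htail, hnearG⟩ := helper_limitBounds S p J ε' hε' hball hJstd u b bstar B G φ hφ
    hu hB hblim hpt R hR (fun ξ hξ => ⟨(hfar ξ hξ).1, (hfar ξ hξ).2.2⟩)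
  obtain ⟨hinjFar, himmFar⟩ := helper_limitHoloFar S p J ε' hε' hball hJstd u b G φ hu hGs hGJ R hR
    hGfar hconvY hdecay
  have hB0 : 0 ≤ max ε'⁻¹ B := (inv_pos.2 hε').le.trans (le_max_left _ _)
  obtain ⟨hproper, hz, hw, hsep⟩ := helper_limitProperSep S p ε' hε' G hGcont bstar R
    (4 * max ε'⁻¹ B * R) hR (by positivity) (fun ξ hξ => ⟨(hfar ξ hξ).1, (hfar ξ hξ).2.1⟩)
    hdecay htail hnearG
  -- the deep step on the core disc (D1b)
  obtain ⟨rc, hrc⟩ : ∃ rc : ℝ, rc = 2 * R + 1 := ⟨_, rfl⟩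
  obtain ⟨ρ₁, hρ₁⟩ : ∃ ρ₁ : ℝ, ρ₁ = 2 * rc + 12 * R + 1 := ⟨_, rfl⟩
  have hrc2 : 2 * R < rc := by rw [hrc]; linarith
  have hρ₁far : 2 * R < ρ₁ := by rw [hρ₁]; nlinarith
  have hρ₁0 : 0 < ρ₁ := by linarith
  have hsep' := hsep rc (by linarith)
  have hinjA : Set.InjOn G {ξ : ℂ | ρ₁ < ‖ξ‖ ∧ ‖ξ‖ < ρ₁ + 1} :=
    hinjFar.mono fun ξ hξ => lt_trans hρ₁far hξ.1
  have himmA : ∀ ξ : ℂ, ρ₁ < ‖ξ‖ → ‖ξ‖ < ρ₁ + 1 →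
      Function.Injective (mfderiv 𝓘(ℝ, ℂ) (𝓡 4) G ξ) :=
    fun ξ hξ _ => himmFar ξ (lt_trans hρ₁far hξ)
  have hsepA : ∀ ξ ξ' : ℂ, ‖ξ‖ ≤ ρ₁ → ρ₁ < ‖ξ'‖ → ‖ξ'‖ < ρ₁ + 1 → G ξ ≠ G ξ' := by
    intro ξ ξ' hξ hξ' _
    rcases le_or_gt ‖ξ‖ rc with h | h
    · exact hsep' ξ ξ' h (by rw [hρ₁] at hξ'; linarith)
    · intro heq
      have hξfar : 2 * R < ‖ξ‖ := lt_trans hrc2 h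
      have hξ'far : 2 * R < ‖ξ'‖ := lt_trans hρ₁far hξ'
      have := hinjFar hξfar hξ'far heq
      rw [this] at hξ
      exact absurd hξ (not_le.2 hξ')
  obtain ⟨hinjD, himmD⟩ := hD1b S p J hJ2 hJs N ι hι hιinj hιd (fun k => u (φ k)) G
    ρ₁ (ρ₁ + 1) hρ₁0 (by linarith) (fun k => (hu (φ k)).1) (fun k => (hu (φ k)).2.1)
    (fun k => (hu (φ k)).2.2.1) hGs hGJ hunif hinjA himmA hsepA
  have hinj : Function.Injective G := by
    intro ξ ξ' heq
    rcases lt_or_ge ‖ξ‖ (ρ₁ + 1) with h1 | h1 <;> rcases lt_or_ge ‖ξ'‖ (ρ₁ + 1) with h2 | h2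
    · exact hinjD (by simpa using h1) (by simpa using h2) heq
    · rcases le_or_gt ‖ξ‖ rc with h3 | h3
      · exact absurd heq (hsep' ξ ξ' h3 (by rw [hρ₁] at h2; linarith))
      · exact hinjFar (lt_trans hrc2 h3) (lt_of_lt_of_le (by linarith) h2) heq
    · rcases le_or_gt ‖ξ'‖ rc with h3 | h3
      · exact absurd heq.symm (hsep' ξ' ξ h3 (by rw [hρ₁] at h1; linarith))
      · exact hinjFar (lt_of_lt_of_le (by linarith) h1) (lt_trans hrc2 h3) heq
    · exact hinjFar (lt_of_lt_of_le (by linarith) h1) (lt_of_lt_of_le (by linarith) h2) heq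
  have himm : ∀ ξ : ℂ, Function.Injective (mfderiv 𝓘(ℝ, ℂ) (𝓡 4) G ξ) := by
    intro ξ
    rcases lt_or_ge ‖ξ‖ (ρ₁ + 1) with h1 | h1
    · exact himmD ξ (by simpa using h1)
    · exact himmFar ξ (lt_of_lt_of_le (by linarith) h1)
  have hne : ∃ z z' : ℂ, G z ≠ G z' := by
    refine ⟨((4 * R : ℝ) : ℂ), ((8 * R : ℝ) : ℂ), fun heq => ?_⟩
    have h := hinj heq
    have : (4 * R : ℝ) = 8 * R := by exact_mod_cast h
    linarith
  have hmem : IsPencilMember J G bstar := ⟨⟨hGs, hne, hGJ⟩, hinj, himm, hproper, hz, hw⟩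
  exact ⟨G, φ, hφ, hmem, hunif⟩


/-- **The hard stub of skeleton v2 from the two deep stubs of v7.** GIVEN A' (IFT chart of the
moduli space of members: existence + universality) and D1b (limits of embedded members are
embedded), the standing hypotheses give complete-pencil data or an entire `J`-curve staying away
from `p`: continuity method (`helper_continuityMethod` over `helper_continuityStep`,
`helper_familyExtend`, `helper_familyUnique`, `helper_farFamily`, `helper_farMemberIsFarLine`) ⇒
global family (else `CurveAway`) ⇒ proper (`helper_familyProper`) ⇒ injective
(`helper_injectiveOfProper`, covering of the simply connected `Σ∖p`) ⇒ diffeomorphism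
(`helper_diffeoOfProperInjective`) ⇒ `substub_completePackaging`. -/
theorem pencilOrRescale_of_localFamilyUniv_of_limitEmbedded
    (hAstub :     ∀ (S : HomotopySphere 4) (p : S.carrier)
      (J : ∀ x : punctured p, TangentSpace (𝓡 4) x →L[ℝ] TangentSpace (𝓡 4) x) (ε' : ℝ),
      0 < ε' →
      Metric.closedBall (extChartAt (𝓡 4) p p) ε' ⊆ (extChartAt (𝓡 4) p).target →
      (∀ (x : punctured p) (v : TangentSpace (𝓡 4) x), J x (J x v) = -v) →
      (∀ x₀ : punctured p, ContMDiffAt (𝓡 4) 𝓘(ℝ, EuclideanSpace ℝ (Fin 4) →L[ℝ] EuclideanSpace ℝ (Fin 4)) ∞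
        (inTangentCoordinates (𝓡 4) (𝓡 4) (id : punctured p → punctured p) id (fun x => J x) x₀) x₀) →
      (∀ x : punctured p, InPuncturedChartBall p ε' x →
        ∀ (v : TangentSpace (𝓡 4) x) (b : EuclideanSpace ℝ (Fin 4)),
          inner ℝ (fderiv ℝ inversion (extChartAt (𝓡 4) p x.1 - extChartAt (𝓡 4) p p)
            (mfderiv (𝓡 4) 𝓘(ℝ, EuclideanSpace ℝ (Fin 4))
              (fun z : punctured p => extChartAt (𝓡 4) p z.1) x (J x v))) b
          = stdSymplecticForm (fderiv ℝ inversion (extChartAt (𝓡 4) p x.1 - extChartAt (𝓡 4) p p)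
            (mfderiv (𝓡 4) 𝓘(ℝ, EuclideanSpace ℝ (Fin 4))
              (fun z : punctured p => extChartAt (𝓡 4) p z.1) x v)) b) →
      ∀ (u₀ : ℂ → punctured p) (b₀ : ℂ), IsPencilMember J u₀ b₀ →
        ∃ δ : ℝ, 0 < δ ∧ ∃ Floc : ℂ → ℂ → punctured p, Floc b₀ = u₀ ∧
          (∀ b ∈ Metric.ball b₀ δ, IsPencilMember J (Floc b) b) ∧
          ContMDiffOn 𝓘(ℝ, ℂ × ℂ) (𝓡 4) ∞ (fun q : ℂ × ℂ => Floc q.1 q.2)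
            ((Metric.ball b₀ δ) ×ˢ (univ : Set ℂ)) ∧
          (∀ q : ℂ × ℂ, q.1 ∈ Metric.ball b₀ δ →
            Function.Injective (mfderiv 𝓘(ℝ, ℂ × ℂ) (𝓡 4) (fun q : ℂ × ℂ => Floc q.1 q.2) q)) ∧
          ∃ (r₀ : ℝ) (V : Set (ℂ × punctured p)), IsOpen V ∧ (∀ ξ : ℂ, (ξ, u₀ ξ) ∈ V) ∧
            ∀ (u : ℂ → punctured p) (b : ℂ), IsPencilMember J u b → b ∈ Metric.ball b₀ δ →
              (∀ ξ : ℂ, ‖ξ‖ ≤ r₀ → (ξ, u ξ) ∈ V) → u = Floc b)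
    (hD1b : ∀ (S : HomotopySphere 4) (p : S.carrier)
      (J : ∀ x : punctured p, TangentSpace (𝓡 4) x →L[ℝ] TangentSpace (𝓡 4) x),
      (∀ (x : punctured p) (v : TangentSpace (𝓡 4) x), J x (J x v) = -v) →
      (∀ x₀ : punctured p, ContMDiffAt (𝓡 4) 𝓘(ℝ, EuclideanSpace ℝ (Fin 4) →L[ℝ] EuclideanSpace ℝ (Fin 4)) ∞
        (inTangentCoordinates (𝓡 4) (𝓡 4) (id : punctured p → punctured p) id (fun x => J x) x₀) x₀) →
      ∀ (N : ℕ) (ι : S.carrier → EuclideanSpace ℝ (Fin N)),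
        ContMDiff (𝓡 4) 𝓘(ℝ, EuclideanSpace ℝ (Fin N)) ∞ ι → Function.Injective ι →
        (∀ x : S.carrier, Function.Injective (mfderiv (𝓡 4) 𝓘(ℝ, EuclideanSpace ℝ (Fin N)) ι x)) →
      ∀ (u : ℕ → ℂ → punctured p) (G : ℂ → punctured p) (r₀ r₁ : ℝ), 0 < r₀ → r₀ < r₁ →
        (∀ n, IsEntireJCurve (𝓡 4) J (u n)) → (∀ n, Function.Injective (u n)) →
        (∀ n (ξ : ℂ), Function.Injective (mfderiv 𝓘(ℝ, ℂ) (𝓡 4) (u n) ξ)) →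
        ContMDiff 𝓘(ℝ, ℂ) (𝓡 4) ∞ G → IsJHolomorphic (𝓡 4) J G →
        (∀ D : Set ℂ, IsCompact D →
          TendstoUniformlyOn (fun n ζ => ι (u n ζ).1) (fun ζ => ι (G ζ).1) atTop D) →
        Set.InjOn G {ξ : ℂ | r₀ < ‖ξ‖ ∧ ‖ξ‖ < r₁} →
        (∀ ξ : ℂ, r₀ < ‖ξ‖ → ‖ξ‖ < r₁ → Function.Injective (mfderiv 𝓘(ℝ, ℂ) (𝓡 4) G ξ)) →
        (∀ ξ ξ' : ℂ, ‖ξ‖ ≤ r₀ → r₀ < ‖ξ'‖ → ‖ξ'‖ < r₁ → G ξ ≠ G ξ') →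
        Set.InjOn G (Metric.ball (0 : ℂ) r₁) ∧
          ∀ ξ ∈ Metric.ball (0 : ℂ) r₁, Function.Injective (mfderiv 𝓘(ℝ, ℂ) (𝓡 4) G ξ)) :
    ∀ (S : HomotopySphere 4) (p : S.carrier)
      (J : ∀ x : punctured p, TangentSpace (𝓡 4) x →L[ℝ] TangentSpace (𝓡 4) x) (ε ε' : ℝ),
      0 < ε → ε < ε' →
      Metric.closedBall (extChartAt (𝓡 4) p p) ε' ⊆ (extChartAt (𝓡 4) p).target →
      (∀ (x : punctured p) (v : TangentSpace (𝓡 4) x), J x (J x v) = -v) →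
      (∀ x₀ : punctured p, ContMDiffAt (𝓡 4) 𝓘(ℝ, EuclideanSpace ℝ (Fin 4) →L[ℝ] EuclideanSpace ℝ (Fin 4)) ∞
        (inTangentCoordinates (𝓡 4) (𝓡 4) (id : punctured p → punctured p) id (fun x => J x) x₀) x₀) →
      (∀ x : punctured p, InPuncturedChartBall p ε' x →
        ∀ (v : TangentSpace (𝓡 4) x) (b : EuclideanSpace ℝ (Fin 4)),
          inner ℝ (fderiv ℝ inversion (extChartAt (𝓡 4) p x.1 - extChartAt (𝓡 4) p p)
            (mfderiv (𝓡 4) 𝓘(ℝ, EuclideanSpace ℝ (Fin 4))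
              (fun z : punctured p => extChartAt (𝓡 4) p z.1) x (J x v))) b
          = stdSymplecticForm (fderiv ℝ inversion (extChartAt (𝓡 4) p x.1 - extChartAt (𝓡 4) p p)
            (mfderiv (𝓡 4) 𝓘(ℝ, EuclideanSpace ℝ (Fin 4))
              (fun z : punctured p => extChartAt (𝓡 4) p z.1) x v)) b) →
      (∃ (F : (ℂ × ℂ) ≃ₘ⟮𝓘(ℝ, ℂ × ℂ), 𝓡 4⟯ (punctured p))
          (Jhat : ℂ × ℂ → (ℂ × ℂ →L[ℝ] ℂ × ℂ)), Continuous Jhat ∧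
        (∀ (q : ℂ × ℂ) (u : ℂ × ℂ),
          mfderiv 𝓘(ℝ, ℂ × ℂ) (𝓡 4) F q (Jhat q u) = J (F q) (mfderiv 𝓘(ℝ, ℂ × ℂ) (𝓡 4) F q u)) ∧
        (∀ (q : ℂ × ℂ) (ζ : ℂ), Jhat q (0, ζ) = (0, Complex.I * ζ)) ∧
        (∀ (q : ℂ × ℂ) (w : ℂ), w ≠ 0 →
          0 < w.re * ((Jhat q (w, 0)).1).im - w.im * ((Jhat q (w, 0)).1).re)) ∨
      (∃ u : ℂ → punctured p, IsEntireJCurve (𝓡 4) J u ∧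
        ∃ η : ℝ, 0 < η ∧ ∀ z : ℂ, ¬ InPuncturedChartBall p η (u z)) := by
  intro S p J ε ε' hε hεε' hball hJ2 hJs hJstd
  have hε' : 0 < ε' := hε.trans hεε'
  -- the instantiated stubs
  have hA := hAstub S p J ε' hε' hball hJ2 hJs hJstd
  have hFar := helper_farMemberIsFarLine S p J ε' hε' hball hJstd
  have hUniq := helper_familyUnique S p J hA
  have hLim := substub_limitMemberConv_of hD1b S p J ε' hε' hball hJ2 hJs hJstd
  have hExt := helper_familyExtend S p J ε' hε' hball hJ2 hJs hJstd hA hLim hUniq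
  have hFarFam := helper_farFamily S p J ε' hε' hball hJstd
  have hStep := helper_continuityStep S p J ε' hε' hball hJstd hFarFam hFar hUniq hExt
  rcases helper_continuityMethod S p J ε' hε' hball hJstd hFarFam hFar hUniq hStep with hcurve | ⟨F, hmem, hsmooth, hinjd⟩
  · exact Or.inr hcurve
  · left
    -- the global map
    obtain ⟨Φ, hΦ⟩ : ∃ Φ : ℂ × ℂ → punctured p, Φ = fun q => F q.1 q.2 := ⟨_, rfl⟩
    have hmem' : ∀ b : ℂ, IsPencilMember J (F b) b := fun b => hmem b (mem_univ b)
    have hΦsmooth : ContMDiff 𝓘(ℝ, ℂ × ℂ) (𝓡 4) ∞ Φ := by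
      rw [hΦ]
      intro q
      exact (hsmooth q ⟨mem_univ _, mem_univ _⟩).contMDiffAt
        ((isOpen_univ.prod isOpen_univ).mem_nhds ⟨mem_univ _, mem_univ _⟩)
    have hΦd : ∀ q : ℂ × ℂ, Function.Injective (mfderiv 𝓘(ℝ, ℂ × ℂ) (𝓡 4) Φ q) := by
      rw [hΦ]
      exact fun q => hinjd q (mem_univ _)
    -- far slices are the far flat lines (FARU)
    have hfar : ∀ b ξ : ℂ, ε'⁻¹ < ‖b‖ →
        InPuncturedChartBall p ε' (F b ξ) ∧ Ycoord p (F b ξ) = (ξ, b) :=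
      fun b ξ hb => hFar (F b) b (hmem' b) hb ξ
    -- properness
    have hΦproper : ∀ K : Set (punctured p), IsCompact K → IsCompact (Φ ⁻¹' K) := by
      intro K hK
      obtain ⟨Bb, r, hBr⟩ := helper_familyProper S p J ε' hε' hball hJstd F ε'⁻¹ hmem' hfar K hK
      have hsub : Φ ⁻¹' K ⊆ Metric.closedBall (0 : ℂ) Bb ×ˢ Metric.closedBall (0 : ℂ) r := by
        rintro ⟨b, ξ⟩ hq
        rw [mem_preimage, hΦ] at hq
        obtain ⟨h1, h2⟩ := hBr b ξ hq
        exact ⟨mem_closedBall_zero_iff.2 h1, mem_closedBall_zero_iff.2 h2⟩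
      exact ((isCompact_closedBall _ _).prod (isCompact_closedBall _ _)).of_isClosed_subset
        (hK.isClosed.preimage hΦsmooth.continuous) hsub
    -- injectivity (INJ) and packaging
    have hΦinj : Function.Injective Φ := helper_injectiveOfProper S p Φ hΦsmooth hΦd hΦproper
    obtain ⟨Fd, hFd⟩ := helper_diffeoOfProperInjective S p Φ hΦsmooth hΦinj hΦd hΦproper
    refine substub_completePackaging S p J ε ε' hε hεε' hball hJ2 hJs hJstd Fd ε'⁻¹
      (fun b => ?_) (fun b ξ hb => ?_)
    · have : (fun ξ => Fd (b, ξ)) = F b := funext fun ξ => by rw [hFd, hΦ]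
      rw [this]
      exact hmem' b
    · rw [hFd, hΦ]
      exact hfar b ξ hb


/-- **The crux modulo its two deep inputs (registered helper
`WitnessCharge_of_localFamilyUniv_of_limitEmbedded`).** GIVEN A' = `substub_localFamilyUniv` and
D1b = `substub_limitEmbedded` of skeleton v7 (line `Sketch`), the route declaration
`Theses.SullivanDual.WitnessCharge` holds: the landed reduction `WitnessCharge_of_pencilOrRescale`
applied to `pencilOrRescale_of_localFamilyUniv_of_limitEmbedded`. -/
theorem WitnessCharge_of_localFamilyUniv_of_limitEmbedded :
    (∀ (S : HomotopySphere 4) (p : S.carrier)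
      (J : ∀ x : punctured p, TangentSpace (𝓡 4) x →L[ℝ] TangentSpace (𝓡 4) x) (ε' : ℝ),
      0 < ε' →
      Metric.closedBall (extChartAt (𝓡 4) p p) ε' ⊆ (extChartAt (𝓡 4) p).target →
      (∀ (x : punctured p) (v : TangentSpace (𝓡 4) x), J x (J x v) = -v) →
      (∀ x₀ : punctured p, ContMDiffAt (𝓡 4) 𝓘(ℝ, EuclideanSpace ℝ (Fin 4) →L[ℝ] EuclideanSpace ℝ (Fin 4)) ∞
        (inTangentCoordinates (𝓡 4) (𝓡 4) (id : punctured p → punctured p) id (fun x => J x) x₀) x₀) →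
      (∀ x : punctured p, InPuncturedChartBall p ε' x →
        ∀ (v : TangentSpace (𝓡 4) x) (b : EuclideanSpace ℝ (Fin 4)),
          inner ℝ (fderiv ℝ inversion (extChartAt (𝓡 4) p x.1 - extChartAt (𝓡 4) p p)
            (mfderiv (𝓡 4) 𝓘(ℝ, EuclideanSpace ℝ (Fin 4))
              (fun z : punctured p => extChartAt (𝓡 4) p z.1) x (J x v))) b
          = stdSymplecticForm (fderiv ℝ inversion (extChartAt (𝓡 4) p x.1 - extChartAt (𝓡 4) p p)
            (mfderiv (𝓡 4) 𝓘(ℝ, EuclideanSpace ℝ (Fin 4))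
              (fun z : punctured p => extChartAt (𝓡 4) p z.1) x v)) b) →
      ∀ (u₀ : ℂ → punctured p) (b₀ : ℂ), IsPencilMember J u₀ b₀ →
        ∃ δ : ℝ, 0 < δ ∧ ∃ Floc : ℂ → ℂ → punctured p, Floc b₀ = u₀ ∧
          (∀ b ∈ Metric.ball b₀ δ, IsPencilMember J (Floc b) b) ∧
          ContMDiffOn 𝓘(ℝ, ℂ × ℂ) (𝓡 4) ∞ (fun q : ℂ × ℂ => Floc q.1 q.2)
            ((Metric.ball b₀ δ) ×ˢ (univ : Set ℂ)) ∧
          (∀ q : ℂ × ℂ, q.1 ∈ Metric.ball b₀ δ →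
            Function.Injective (mfderiv 𝓘(ℝ, ℂ × ℂ) (𝓡 4) (fun q : ℂ × ℂ => Floc q.1 q.2) q)) ∧
          ∃ (r₀ : ℝ) (V : Set (ℂ × punctured p)), IsOpen V ∧ (∀ ξ : ℂ, (ξ, u₀ ξ) ∈ V) ∧
            ∀ (u : ℂ → punctured p) (b : ℂ), IsPencilMember J u b → b ∈ Metric.ball b₀ δ →
              (∀ ξ : ℂ, ‖ξ‖ ≤ r₀ → (ξ, u ξ) ∈ V) → u = Floc b) →
    (∀ (S : HomotopySphere 4) (p : S.carrier)
      (J : ∀ x : punctured p, TangentSpace (𝓡 4) x →L[ℝ] TangentSpace (𝓡 4) x),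
      (∀ (x : punctured p) (v : TangentSpace (𝓡 4) x), J x (J x v) = -v) →
      (∀ x₀ : punctured p, ContMDiffAt (𝓡 4) 𝓘(ℝ, EuclideanSpace ℝ (Fin 4) →L[ℝ] EuclideanSpace ℝ (Fin 4)) ∞
        (inTangentCoordinates (𝓡 4) (𝓡 4) (id : punctured p → punctured p) id (fun x => J x) x₀) x₀) →
      ∀ (N : ℕ) (ι : S.carrier → EuclideanSpace ℝ (Fin N)),
        ContMDiff (𝓡 4) 𝓘(ℝ, EuclideanSpace ℝ (Fin N)) ∞ ι → Function.Injective ι →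
        (∀ x : S.carrier, Function.Injective (mfderiv (𝓡 4) 𝓘(ℝ, EuclideanSpace ℝ (Fin N)) ι x)) →
      ∀ (u : ℕ → ℂ → punctured p) (G : ℂ → punctured p) (r₀ r₁ : ℝ), 0 < r₀ → r₀ < r₁ →
        (∀ n, IsEntireJCurve (𝓡 4) J (u n)) → (∀ n, Function.Injective (u n)) →
        (∀ n (ξ : ℂ), Function.Injective (mfderiv 𝓘(ℝ, ℂ) (𝓡 4) (u n) ξ)) →
        ContMDiff 𝓘(ℝ, ℂ) (𝓡 4) ∞ G → IsJHolomorphic (𝓡 4) J G →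
        (∀ D : Set ℂ, IsCompact D →
          TendstoUniformlyOn (fun n ζ => ι (u n ζ).1) (fun ζ => ι (G ζ).1) atTop D) →
        Set.InjOn G {ξ : ℂ | r₀ < ‖ξ‖ ∧ ‖ξ‖ < r₁} →
        (∀ ξ : ℂ, r₀ < ‖ξ‖ → ‖ξ‖ < r₁ → Function.Injective (mfderiv 𝓘(ℝ, ℂ) (𝓡 4) G ξ)) →
        (∀ ξ ξ' : ℂ, ‖ξ‖ ≤ r₀ → r₀ < ‖ξ'‖ → ‖ξ'‖ < r₁ → G ξ ≠ G ξ') →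
        Set.InjOn G (Metric.ball (0 : ℂ) r₁) ∧
          ∀ ξ ∈ Metric.ball (0 : ℂ) r₁, Function.Injective (mfderiv 𝓘(ℝ, ℂ) (𝓡 4) G ξ)) →
    Summit.SmoothPoincare4.SmoothPoincare4.Theses.SullivanDual.WitnessCharge :=
  fun hAstub hD1b =>
    WitnessCharge_of_pencilOrRescale (pencilOrRescale_of_localFamilyUniv_of_limitEmbedded hAstub hD1b)

end Summit.SmoothPoincare4.SmoothPoincare4.Theorems.WitnessCharge.PencilIncompleteness
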